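import Summits.HodgeConjecture.CorCM.MultiFieldWeilDihedralDecicShowcase
import Summits.HodgeConjecture.CorCM.MultiFieldWeilDihedralMeet
import HarnessLib

/-!
# MULTI-FIELD WEIL ENGINE — SHOWCASE, FREENESS BY INSPECTION: two fivefolds of `k`-signature `(2,3)` over ONE dihedral decic CM field whose types are DIFFERENT and SHARE a
# `τ`-embedding, with the CM curve — the Hodge conjecture for every product of copies, given only Markman's hyperbolic-sixfold theorem

Cell `pub-hodgecm2` (COR-CM), seat b30 gen 42 (2026-08-26); count-neutral own lane MULTI-FIELD WEIL ENGINE (stem `MultiFieldWeil*`), the sequel of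
`CorCM/MultiFieldWeilDihedralDecicShowcase.lean` (`hodgeConjectureFor_biproduct_dihedralDecicPair`, freeness hypothesis on automorphisms of `ℂ`) and
`CorCM/MultiFieldWeilDihedralMeet.lean` (`eq_one_of_stab_meeting_realisedTuples`).  Theorems only; no definition, no named fact, no `sorry`.  HONEST FRAMING: conditional ONLY on the
displayed Markman binder `hM6`; `HC_CM` is NOT proved and not asserted.

* **`comp_eq_of_stab_of_meet`** (field level): `K ⊇ iK(k)` a decic CM field, `k` imaginary quadratic, Galois closure of `K` in `ℂ` of degree `≤ 20`, a `τ`-embedding with a value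
  outside the image of another (DIHEDRAL quintic part); two CM types `Ψ₀`, `Ψ₁` of `K` with two members over `τ` each, whose `τ`-parts are DIFFERENT and SHARE an embedding; then
  every automorphism of `ℂ` over `τ(k)` stabilising both `τ`-parts fixes every `τ`-embedding of `K` — the hypothesis `hfree` of the showcase, by inspection of the two types
  (a one-slot instance of the engine + `eq_one_of_stab_meeting_realisedTuples`).
* **`hodgeConjectureFor_biproduct_dihedralDecicPair_of_meet`**: `E ⊨ (k; {τ})`, `B₀ ⊨ (K; Ψ₀)`, `B₁ ⊨ (K; Ψ₁)` as above ⟹ the Hodge conjecture for every product of copies of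
  `E, B₀, B₁` and (dominated form) for every abelian variety dominated by one, GIVEN ONLY Markman's hyperbolic-sixfold theorem.  In words: **over a decic CM field `K = k·K⁺` with
  `K⁺` a real quintic `D₅`-field, ANY TWO `(2,3)`-fivefolds whose CM types differ on and share one of the five `τ`-embeddings, times any powers of the CM curve of `k`, satisfy
  the Hodge conjecture modulo Markman's theorem** (the `5` pairs {edge, disjoint diagonal} of the pentagon remain — honestly — outside: `CorCM/MultiFieldWeilCommutantNoGo.lean`).
[cite: Markman2025SecantWeil, Thm 1.5.1] [cite: Shimura1998, §6.1 Corollary of Theorem 2, §8.4, §18.2 Lemma (i)] [cite: DixonMortimer1996, §1.6, Thm. 1.6A; §2.1; §3.3]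
[cite: Serre1977, §5.3] [cite: Lang2002, VI §1 Thm. 1.1 and V §2 Thm. 2.8; XIII §4] [cite: MumfordAV1970, §19]

## References
* [Markman2025SecantWeil] E. Markman, Cycles on abelian 2n-folds of Weil type from secant sheaves on abelian n-folds, Thm 1.5.1.  [Shimura1998] G. Shimura, *Abelian varieties with
  complex multiplication and modular functions*, §6.1, §8.4, §18.2.  [DixonMortimer1996] J. D. Dixon, B. Mortimer, *Permutation Groups*, GTM 163.  [Serre1977] J.-P. Serre,
  *Linear Representations of Finite Groups*, GTM 42, §5.3.  [Lang2002] S. Lang, *Algebra*, GTM 211.  [MumfordAV1970] D. Mumford, *Abelian Varieties*, §19.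
-/

noncomputable section

open CategoryTheory CategoryTheory.Limits NumberField IntermediateField

namespace Summit.HodgeConjecture.CorCM.MultiFieldWeil

open Finset
open Literature.AlgebraicGeometry Literature.AlgebraicGeometry.Motives Literature.AlgebraicGeometry.HodgeTheory
open Literature.AlgebraicGeometry.ComplexMultiplication (IsCMTypeRealisation)
open Literature.AlgebraicTopology.SingularHomology
open Literature.NumberTheory.ComplexMultiplication

open scoped Classical

section Field

variable {K : Type} [fK : Field K] [nK : NumberField K] [cK : IsCMField K] {k : Type} [fk : Field k] [nk : NumberField k] [ck : IsCMField k] {τ : k →+* ℂ}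

omit cK in
/-- **FREENESS BY INSPECTION (field level).**  Over a decic CM field `K ⊇ iK(k)` (`k` imaginary quadratic) with Galois closure of degree `≤ 20` in `ℂ` and a `τ`-embedding value
outside the image of another, two families-of-two `τ`-parts `T t = {s over τ : s ∈ Ψ t}` (`t : Fin 2`) that are DIFFERENT and SHARE an embedding are stabilised together only by
automorphisms of `ℂ` over `τ(k)` fixing every `τ`-embedding of `K`. [cite: DixonMortimer1996, §1.6, Thm. 1.6A; §3.3] [cite: Lang2002, VI §1 Thm. 1.1] [cite: Shimura1998, §18.2 Lemma (i)] -/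
theorem comp_eq_of_stab_of_meet (h2 : Module.finrank ℚ k = 2) (iK : k →+* K) (h10 : Module.finrank ℚ K = 10)
    (h20 : Module.finrank ℚ ↥(normalClosure ℚ K ℂ) ≤ 20) (hns : ∃ s₀ t₀ : K →+* ℂ, s₀.comp iK = τ ∧ t₀.comp iK = τ ∧ ∃ x, t₀ x ∉ adjoin ℚ (Set.range s₀))
    (Ψ : Fin 2 → CMType K) (hcnt : ∀ t, (Finset.univ.filter fun s : K →+* ℂ => s.comp iK = τ ∧ s ∈ (Ψ t).1).card = 2)
    (hdist : (Finset.univ.filter fun s : K →+* ℂ => s.comp iK = τ ∧ s ∈ (Ψ 0).1) ≠ (Finset.univ.filter fun s : K →+* ℂ => s.comp iK = τ ∧ s ∈ (Ψ 1).1))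
    (hmeet : ∃ s : K →+* ℂ, s.comp iK = τ ∧ s ∈ (Ψ 0).1 ∧ s ∈ (Ψ 1).1)
    (ρ : ℂ ≃+* ℂ) (hρ : (ρ : ℂ →+* ℂ).comp τ = τ) (hstab : ∀ (t : Fin 2) (s : K →+* ℂ), s.comp iK = τ → (s ∈ (Ψ t).1 ↔ (ρ : ℂ →+* ℂ).comp s ∈ (Ψ t).1))
    (s : K →+* ℂ) (hs : s.comp iK = τ) : (ρ : ℂ →+* ℂ).comp s = s := by
  have hττ : ComplexEmbedding.conjugate τ ≠ τ := QuarticCM.conjugate_ne τ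
  have hk : ∀ σ : k →+* ℂ, σ = τ ∨ σ = ComplexEmbedding.conjugate τ := fun σ => QuarticCM.eq_or_eq_conjugate_of_quadratic h2 τ σ
  have h10' : Module.finrank ℚ K = 2 * 5 := by rw [h10]
  obtain ⟨E₀, hE_sign, -⟩ := exists_signFrame h10' h2 iK hττ hk
  -- a one-slot instance of the engine: fields `Option.elim · k (fun _ => K)`
  let Kf : Option Unit → Type := fun o => o.elim k fun _ => K
  letI instF : ∀ o, Field (Kf o) := fun o => @Option.rec Unit (fun o => Field (Option.elim o k fun _ => K)) fk (fun _ => fK) o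
  letI instN : ∀ o, NumberField (Kf o) := fun o => @Option.rec Unit (fun o => NumberField (Option.elim o k fun _ => K)) nk (fun _ => nK) o
  let is : Fin 1 → Option Unit := fun _ => some ()
  let im : ∀ m : Fin 1, Kf none →+* Kf (is m) := fun _ => iK
  let e : ∀ m : Fin 1, (Kf (is m) →+* ℂ) ≃ Fin ((fun _ : Fin 1 => 5) m) × Bool := fun _ => E₀
  have he_sign : ∀ (m : Fin 1) (s : Kf (is m) →+* ℂ), (e m s).2 = true ↔ s.comp (im m) = τ := fun _ s => hE_sign s
  -- the realised tuple of `ρ`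
  obtain ⟨π, hπ, hπe⟩ := exists_mem_realisedTuples_of_comp_tau_eq (Kf := Kf) (i₀ := none) (is := is) (e := e) (τ := τ) (im := im) he_sign ρ hρ
  -- the two position sets
  let Q : Fin 2 → Finset (Fin 5) := fun t => Finset.univ.filter fun a : Fin 5 => E₀.symm (a, true) ∈ (Ψ t).1
  have hmemQ : ∀ t a, a ∈ Q t ↔ E₀.symm (a, true) ∈ (Ψ t).1 := fun t a => by simp only [Q, Finset.mem_filter, Finset.mem_univ, true_and]
  have hQ : ∀ t, (Q t).card = 2 := fun t => (card_posSet (hE_sign) (Ψ t)).trans (hcnt t)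
  have hsa : ∀ s : K →+* ℂ, s.comp iK = τ → E₀.symm ((E₀ s).1, true) = s := fun s hs => by
    rw [show ((E₀ s).1, true) = E₀ s from Prod.ext rfl ((hE_sign s).2 hs).symm, Equiv.symm_apply_apply]
  have hij : Q 0 ≠ Q 1 := by
    intro hQQ
    apply hdist
    ext s
    simp only [Finset.mem_filter, Finset.mem_univ, true_and]
    constructor
    · rintro ⟨hs, h0⟩
      refine ⟨hs, ?_⟩
      have := (hmemQ 0 (E₀ s).1).2 (by rw [hsa s hs]; exact h0)
      rw [hQQ, hmemQ, hsa s hs] at this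
      exact this
    · rintro ⟨hs, h1⟩
      refine ⟨hs, ?_⟩
      have := (hmemQ 1 (E₀ s).1).2 (by rw [hsa s hs]; exact h1)
      rw [← hQQ, hmemQ, hsa s hs] at this
      exact this
  have hmeetQ : (Q 0 ∩ Q 1).Nonempty := by
    obtain ⟨s', hs', h0, h1⟩ := hmeet
    refine ⟨(E₀ s').1, Finset.mem_inter.2 ⟨?_, ?_⟩⟩
    · rw [hmemQ, hsa s' hs']; exact h0
    · rw [hmemQ, hsa s' hs']; exact h1
  have hstabπ : ∀ (t : Fin 2) (x : Fin 5), π 0 x ∈ Q t ↔ x ∈ Q t := by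
    intro t x
    have hx : (E₀.symm (x, true)).comp iK = τ := (hE_sign _).1 (by simp)
    have hx' : (ρ : ℂ →+* ℂ).comp (E₀.symm (x, true)) = E₀.symm (π 0 x, true) := hπe 0 x
    rw [hmemQ, hmemQ, ← hx']
    exact (hstab t _ hx).symm
  have h1 : π 0 = 1 := eq_one_of_stab_meeting_realisedTuples (Kf := Kf) (i₀ := none) (is := is) (e := e) (τ := τ) (im := im) he_sign 0 rfl h2 h20 hns Q hQ hij hmeetQ π hπ hstabπ
  have this : (ρ : ℂ →+* ℂ).comp (E₀.symm ((E₀ s).1, true)) = E₀.symm (π 0 (E₀ s).1, true) := hπe 0 (E₀ s).1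
  rw [h1, Equiv.Perm.one_apply, hsa s hs] at this
  exact this

end Field

section Showcase

variable {K : Type} [fK : Field K] [nK : NumberField K] [cK : IsCMField K] {k : Type} [fk : Field k] [nk : NumberField k] [ck : IsCMField k] {τ : k →+* ℂ}
  {B : Fin 2 → AbelianVariety ℂ} {Ψ : Fin 2 → CMType K} {ιB : ∀ t : Fin 2, 𝓞 K →+* End (B t)} {θB : ∀ t : Fin 2, K →+* Module.End ℂ (complexBetti (B t).X 1)}
  {E : AbelianVariety ℂ} {Φ₀ : CMType k} {ιE : 𝓞 k →+* End E} {θE : k →+* Module.End ℂ (complexBetti E.X 1)}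

/-- **TWO `(2,3)`-FIVEFOLDS OVER ONE DIHEDRAL DECIC CM FIELD WHOSE TYPES DIFFER ON AND SHARE A `τ`-EMBEDDING, WITH THE CM CURVE — GIVEN ONLY MARKMAN'S HYPERBOLIC-SIXFOLD
THEOREM.**  See the module docstring.  `HC_CM` is NOT asserted. [cite: Markman2025SecantWeil, Thm 1.5.1] [cite: Shimura1998, §6.1 Corollary of Theorem 2, §8.4, §18.2]
[cite: DixonMortimer1996, §1.6, Thm. 1.6A; §2.1; §3.3] [cite: Serre1977, §5.3] [cite: Lang2002, VI §1 Thm. 1.1; XIII §4] -/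
theorem hodgeConjectureFor_biproduct_dihedralDecicPair_of_meet (hM6 : Markman2025_weilClasses_algebraic_hyperbolicSixfold) (h2 : Module.finrank ℚ k = 2) (iK : k →+* K)
    (h10 : Module.finrank ℚ K = 10) (hB : ∀ t, IsCMTypeRealisation (Ψ t) (B t) (ιB t) (θB t)) (hE : IsCMTypeRealisation Φ₀ E ιE θE)
    (hΦ₀ : ∀ σ : k →+* ℂ, σ ∈ Φ₀.1 ↔ σ = τ) (hcnt : ∀ t, (Finset.univ.filter fun s : K →+* ℂ => s.comp iK = τ ∧ s ∈ (Ψ t).1).card = 2)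
    (h20 : Module.finrank ℚ ↥(normalClosure ℚ K ℂ) ≤ 20) (hns : ∃ s₀ t₀ : K →+* ℂ, s₀.comp iK = τ ∧ t₀.comp iK = τ ∧ ∃ x, t₀ x ∉ adjoin ℚ (Set.range s₀))
    (hdist : (Finset.univ.filter fun s : K →+* ℂ => s.comp iK = τ ∧ s ∈ (Ψ 0).1) ≠ (Finset.univ.filter fun s : K →+* ℂ => s.comp iK = τ ∧ s ∈ (Ψ 1).1))
    (hmeet : ∃ s : K →+* ℂ, s.comp iK = τ ∧ s ∈ (Ψ 0).1 ∧ s ∈ (Ψ 1).1)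
    {N : ℕ} (κ : Fin N → Option (Fin 2)) :
    HodgeConjectureFor (⨁ fun l => ((κ l).elim E B : AbelianVariety ℂ)).dim (⨁ fun l => ((κ l).elim E B : AbelianVariety ℂ)).X :=
  hodgeConjectureFor_biproduct_dihedralDecicPair hM6 h2 iK h10 hB hE hΦ₀ hcnt h20 hns
    (fun ρ hρ hst s hs => comp_eq_of_stab_of_meet h2 iK h10 h20 hns Ψ hcnt hdist hmeet ρ hρ hst s hs) κ

/-- **Dominated form.** [cite: Markman2025SecantWeil, Thm 1.5.1] [cite: MumfordAV1970, §19] -/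
theorem hodgeConjectureFor_of_avDominatedBy_dihedralDecicPair_of_meet (hM6 : Markman2025_weilClasses_algebraic_hyperbolicSixfold) (h2 : Module.finrank ℚ k = 2)
    (iK : k →+* K) (h10 : Module.finrank ℚ K = 10) (hB : ∀ t, IsCMTypeRealisation (Ψ t) (B t) (ιB t) (θB t)) (hE : IsCMTypeRealisation Φ₀ E ιE θE)
    (hΦ₀ : ∀ σ : k →+* ℂ, σ ∈ Φ₀.1 ↔ σ = τ) (hcnt : ∀ t, (Finset.univ.filter fun s : K →+* ℂ => s.comp iK = τ ∧ s ∈ (Ψ t).1).card = 2)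
    (h20 : Module.finrank ℚ ↥(normalClosure ℚ K ℂ) ≤ 20) (hns : ∃ s₀ t₀ : K →+* ℂ, s₀.comp iK = τ ∧ t₀.comp iK = τ ∧ ∃ x, t₀ x ∉ adjoin ℚ (Set.range s₀))
    (hdist : (Finset.univ.filter fun s : K →+* ℂ => s.comp iK = τ ∧ s ∈ (Ψ 0).1) ≠ (Finset.univ.filter fun s : K →+* ℂ => s.comp iK = τ ∧ s ∈ (Ψ 1).1))
    (hmeet : ∃ s : K →+* ℂ, s.comp iK = τ ∧ s ∈ (Ψ 0).1 ∧ s ∈ (Ψ 1).1)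
    {N : ℕ} (κ : Fin N → Option (Fin 2)) {X : AbelianVariety ℂ} (hX : Domination.AVDominatedBy X (⨁ fun l => ((κ l).elim E B : AbelianVariety ℂ))) :
    HodgeConjectureFor X.dim X.X :=
  Domination.hodgeConjectureFor_of_avDominatedBy
    (hodgeConjectureFor_biproduct_dihedralDecicPair_of_meet hM6 h2 iK h10 hB hE hΦ₀ hcnt h20 hns hdist hmeet κ) hX

end Showcase

end Summit.HodgeConjecture.CorCM.MultiFieldWeil

end
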